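import Summits.QuantumFields.BalabanUV.Beta.GAN24.SymContactBorderEntryBoundTwoMf
import Summits.QuantumFields.BalabanUV.Beta.GAN24.Push3LegTelescope

import Summits.QuantumFields.BalabanUV.Beta.GAN24.ContactBorderPairEntryBound

/-!
# `GAN24.SymContactBorderPairEntryBound` — THE PAIR ENTRY BOUNDS `abs_contact_border_fm∕mf_le₂` assembled for the V contact PAIR at an1's symmetrised border table — the sym
# twin of leaf-03's (E) `GAN24.ContactBorderPairEntryBound` (the `hPcV` lane; `pair_fm∕mf_eq_three` are the (E) file's, BY NAME)

NOT IN PRINT — OUR BOOKKEEPING (OWNER `b2b-balaban-gan24-p1` gen 55, 2026-08-28; row G-an2-4 ∕ (CONV-C), TRANSFER-III, the (III′) S-slot (b), born-V contact letters `hCv ∕ hPcV`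
of road-P2 M.104 — TABLE HALF at an1's (0.4)-SYMMETRISED border table `symVhSAt ρ` and (0.4) packed first-order kernel `linSym04At ρ L` (the OWNER's memo `HCV-DESIGN-g55.md` §1∕§2):
a mkroot-style token re-run of the (E) file named below with `vhSAt ρ ↦ symVhSAt ρ`, `linSymAt ↦ linSym04At`, `linKerAt ∕ linCountAt ∕ linAvgAt ↦ symLinKerAt ∕ symLinCountAt ∕ symLinAvgAt`
(an1's `SymAveragingHessianCounts`, d1's `SymmetrisedAxialPotential`), the `q¹`-pairing normalisation `(L^{d+1})⁻¹ ↦ ((d+1)!·L^{d+1})⁻¹` (leaf-02 g55 `SymLinKernelExpansion.tsum_sum_symLinKerAt_mul`)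
and the count constant `L^{d+1}·ℓ ↦ (d+1)!·(L^{d+1}·ℓ)` (an1's `abs_symLinCountAt_le`, leaf-01 g90's `SymContactFaceJumpCommutator.sum_abs_symLinCountAt_le`) carried VERBATIM through every
statement; every TABLE-FREE lemma of the (E) files is consumed BY NAME (not copied), and leaf-01 g90's `SymContactFaceJump ∕ SymContactFaceJumpCommutator` supply the shared sym
count ∕ commutator letters.  [folklore] bookkeeping; 0 `def`, 0 cited fact, 0 `def … : Prop`, 0 sorry; NO estimate of Bałaban's beyond an1's DEFINED kernels.
HONEST FRAMING (cell contract, verbatim): «discharging `BetaPertH` makes Bałaban's UV stability UNCONDITIONAL — a real constructive-QFT result; it is NOT the continuum limit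
and NOT the Clay problem.»  HONEST DEPENDENCY (verbatim): «continuum YM on T⁴ ⇐ BetaPertH ∧ nine spine estimates (0/9 proved); BetaPertH ⇐ (D1) ∧ (D4) ∧ CAP+tail; G-an2-4
gates asym, D1 and NE2/3/4.»  Discharges NO letter of M.104 ∕ of the OWNER's END `CombChargeRowsOfBornContactLetters` (hCv ∕ hPcV stay HYPOTHESES); NEVER «G-an2-4 closed» as
(CONV-C); NOT D1, NOT BetaPertH, NOT continuum, NOT Clay.  2026-08-28; no existing file touched.

## What (same statements as the (E) file under the substitutions above; `Sym…` namespace)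
`abs_contact_border_fm_pair_le`, `abs_contact_border_mf_pair_le`.
-/

noncomputable section

open Summit.QuantumFields.BalabanUV.Beta.GAN24.ContactBorderPairEntryBound (pair_fm_eq_three pair_mf_eq_three)

open Finset
open scoped BigOperators
open Literature.MathematicalPhysics.QuantumFieldTheory
open Literature.MathematicalPhysics.QuantumFieldTheory.LatticeForm (quo)
open Literature.MathematicalPhysics.QuantumFieldTheory.Balaban1983to89
open Literature.MathematicalPhysics.QuantumFieldTheory.Balaban1983to89.Beta
open B4ContourShift (supNorm supNorm_nonneg)
open ExpKernelCalculus (MKer Zl Zl_nonneg)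
open AffineAveraging (Form0 Form1 Site box toSite unitVec dz)
open AffineReproduction (dz_sub)
open AveragingContours (blk)
open AveragingHessianKernels (ell)

open OneStepResolventKernel (Fib LocStencil)
open Summit.QuantumFields.BalabanUV.Beta.GAN24.SrecLinearPartEq (reslot)
open Summit.QuantumFields.BalabanUV.Beta.GAN24.Push3 (push₃)
open Summit.QuantumFields.BalabanUV.Beta.GAN24.Push3LegTelescope (push₃_telescope abs_le_of_env' summable_of_env')
open Summit.QuantumFields.BalabanUV.Beta.GAN24.SymContactBorderKernelCells (locStencil_reslot_symVhSAt)
open Summit.QuantumFields.BalabanUV.Beta.GAN24.SymContactBorderEntryBoundTwo (abs_contact_border_fm_le₂)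
open Summit.QuantumFields.BalabanUV.Beta.GAN24.SymContactBorderEntryBoundTwoMf (abs_contact_border_mf_le₂)

open Summit.QuantumFields.BalabanUV.Beta.SymAveragingHessianCounts (symVhSAt symVhSAt_symm locStencil_symVhSAt symLinCountAt symLinKerAt abs_symLinCountAt_le abs_symLinKerAt_le symLinCountAt_eq_zero symLinKerAt_eq_zero)

namespace Summit.QuantumFields.BalabanUV.Beta.GAN24.SymContactBorderPairEntryBound

variable {d : ℕ} {Lc : ℕ} {rr : Fin (d + 1) → ℕ}

/-! ## §1 The pair telescopes into three sockets -/

section Split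

variable {S : Fin (d + 1) → (Fin (d + 1) → ℤ) → MKer (d + 1) (Fib d)} {Cs δ CT CTp CB CBp CM CMp : ℝ}
  {T B Tp Bp M Mp : Fin (d + 1) → (Fin (d + 1) → ℤ) → Fin (d + 1) → (Fin (d + 1) → ℤ) → ℝ}



end Split

/-! ## §2 The entry bound of the fm pair -/

section Fm

variable [NeZero Lc] {n : ℕ} {κ αg αΔ KB KΔ CT CTp Tb TΔ : ℝ}
  {T B Tp Bp M Mp : Fin (d + 1) → (Fin (d + 1) → ℤ) → Fin (d + 1) → (Fin (d + 1) → ℤ) → ℝ}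
  {lam lamp : Fin (d + 1) → (Fin (d + 1) → ℤ) → (Fin (d + 1) → ℤ) → ℝ}
  {G Gp GΔ : Fin (d + 1) → (Fin (d + 1) → ℤ) → ℕ → Site (d + 1) → ℝ}

/-- NOT IN PRINT; OUR BOOKKEEPING ([folklore]; every analytic input a LETTER).  **THE ENTRY BOUND OF THE fm PAIR.**  Shorter tower `(T, B, λ, G)` and taller tower `(T⁺, B⁺, λ⁺, G⁺)` as in (B2)
(dressed legs bounded with summable fine slices, undressed legs under the block envelope `K_B` at blocking `Lc^{n+1}`, `T − B = dz λ`, staircases of depth `n+1` with localised geometric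
pieces of letter `α_g` — the SAME letters for both towers), multipliers `M, M⁺` (summable fine slices, tent letter `T_b` at blocking `Lc^n`), and the DIFFERENCE letters: undressed legs
`|B⁺ − B| ≤ K_Δ·e^{−κ‖quo (Lc^{n+1}) u − z‖∞}`, staircases `λ⁺ − λ = Σ_{s<n+1} G_Δ s ∘ blk (Lc^s)` with pieces of letter `α_Δ`, tents `|(M⁺ − M) β z′ μ (Lc•y)| ≤ T_Δ·e^{−κ‖quo (Lc^n) y − z′‖∞}`.
THEN for all `κ′ u′ x′ z′ α β` (fm entries, `S = reslot inl inr V_ρ`):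
`|(push₃ T⁺ M⁺ T⁺ S − push₃ B⁺ M⁺ B⁺ S) − (push₃ T M T S − push₃ B M B S)| ≤ (Lc^{d+1})⁻¹·((d+1)·(E₀²·Cnt))·[T_b·(K_B·A(α_Δ) + P(α_Δ,α_g) + K_Δ·A(α_g)) + T_Δ·(K_B·A(α_g) + P(α_g,α_g) + K_B·A(α_g))`
`+ T_b·(K_Δ·A(α_g) + P(α_g,α_Δ) + K_B·A(α_Δ))]·((Lc^n)^{d+1}·Zl(κ∕(4(d+1))))·e^{−(κ∕12)(‖x′−z′‖∞+‖u′−z′‖∞)}` — §1 and (A) thrice. -/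
theorem abs_contact_border_fm_pair_le (hLc : 1 ≤ Lc) (hrr : rr ∈ box (d + 1) Lc) (hκ : 0 < κ) (hαg : 0 ≤ αg) (hαΔ : 0 ≤ αΔ) (hKB : 0 ≤ KB)
    (hKΔ : 0 ≤ KΔ) (hTb : 0 ≤ Tb) (hTΔ : 0 ≤ TΔ)
    (hT : ∀ μ z κ u, |T μ z κ u| ≤ CT) (hTs : ∀ μ z κ, Summable fun u => T μ z κ u)
    (hB : ∀ μ z l u, |B μ z l u| ≤ KB * Real.exp (-(κ * supNorm (quo (Lc ^ (n + 1)) u - z))))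
    (hTB : T - B = fun μ z κ u => dz (lam μ z) κ u)
    (hψ : ∀ μ₀ z₀ u, lam μ₀ z₀ u = ∑ s ∈ Finset.range (n + 1), G μ₀ z₀ s (blk (Lc ^ s) u))
    (hG : ∀ μ₀ z₀ s, s ≤ n → ∀ u, |G μ₀ z₀ s (blk (Lc ^ s) u)| ≤ αg * (Lc : ℝ) ^ s * Real.exp (-(κ * supNorm (quo (Lc ^ (n + 1)) u - z₀))))
    (hTp : ∀ μ z κ u, |Tp μ z κ u| ≤ CTp) (hTps : ∀ μ z κ, Summable fun u => Tp μ z κ u)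
    (hBp : ∀ μ z l u, |Bp μ z l u| ≤ KB * Real.exp (-(κ * supNorm (quo (Lc ^ (n + 1)) u - z))))
    (hTBp : Tp - Bp = fun μ z κ u => dz (lamp μ z) κ u)
    (hψp : ∀ μ₀ z₀ u, lamp μ₀ z₀ u = ∑ s ∈ Finset.range (n + 1), Gp μ₀ z₀ s (blk (Lc ^ s) u))
    (hGp : ∀ μ₀ z₀ s, s ≤ n → ∀ u, |Gp μ₀ z₀ s (blk (Lc ^ s) u)| ≤ αg * (Lc : ℝ) ^ s * Real.exp (-(κ * supNorm (quo (Lc ^ (n + 1)) u - z₀))))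
    (hBΔ : ∀ μ z l u, |Bp μ z l u - B μ z l u| ≤ KΔ * Real.exp (-(κ * supNorm (quo (Lc ^ (n + 1)) u - z))))
    (hψΔ : ∀ μ₀ z₀ u, lamp μ₀ z₀ u - lam μ₀ z₀ u = ∑ s ∈ Finset.range (n + 1), GΔ μ₀ z₀ s (blk (Lc ^ s) u))
    (hGΔ : ∀ μ₀ z₀ s, s ≤ n → ∀ u, |GΔ μ₀ z₀ s (blk (Lc ^ s) u)| ≤ αΔ * (Lc : ℝ) ^ s * Real.exp (-(κ * supNorm (quo (Lc ^ (n + 1)) u - z₀))))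
    (hMs : ∀ β z' μ, Summable fun z => M β z' μ z) (hMps : ∀ β z' μ, Summable fun z => Mp β z' μ z)
    (hMt : ∀ (β : Fin (d + 1)) (z' : Site (d + 1)) (μ : Fin (d + 1)) (y : Site (d + 1)),
      |M β z' μ ((Lc : ℤ) • y)| ≤ Tb * Real.exp (-(κ * supNorm (quo (Lc ^ n) y - z'))))
    (hMpt : ∀ (β : Fin (d + 1)) (z' : Site (d + 1)) (μ : Fin (d + 1)) (y : Site (d + 1)),
      |Mp β z' μ ((Lc : ℤ) • y)| ≤ Tb * Real.exp (-(κ * supNorm (quo (Lc ^ n) y - z'))))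
    (hMΔt : ∀ (β : Fin (d + 1)) (z' : Site (d + 1)) (μ : Fin (d + 1)) (y : Site (d + 1)),
      |Mp β z' μ ((Lc : ℤ) • y) - M β z' μ ((Lc : ℤ) • y)| ≤ TΔ * Real.exp (-(κ * supNorm (quo (Lc ^ n) y - z'))))
    (κ' : Fin (d + 1)) (u' x' z' : Site (d + 1)) (α β : Fin (d + 1)) :
    |(push₃ Tp Mp Tp (reslot Sum.inl Sum.inr (symVhSAt (toSite rr) d Lc rfl)) κ' u' x' z' (Sum.inl α) (Sum.inl β)
          - push₃ Bp Mp Bp (reslot Sum.inl Sum.inr (symVhSAt (toSite rr) d Lc rfl)) κ' u' x' z' (Sum.inl α) (Sum.inl β))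
        - (push₃ T M T (reslot Sum.inl Sum.inr (symVhSAt (toSite rr) d Lc rfl)) κ' u' x' z' (Sum.inl α) (Sum.inl β)
          - push₃ B M B (reslot Sum.inl Sum.inr (symVhSAt (toSite rr) d Lc rfl)) κ' u' x' z' (Sum.inl α) (Sum.inl β))|
      ≤ ((((d + 1).factorial : ℕ) : ℝ) * (Lc : ℝ) ^ (d + 1))⁻¹ *
          ((((d : ℝ) + 1) * (Real.exp (2 * ((d : ℝ) + 1) * κ) ^ 2 *
              (((2 * Lc : ℕ) : ℝ) ^ (d + 1) * (((d + 1 : ℕ) : ℝ) * ((((d + 1).factorial : ℕ) : ℝ) * ((Lc : ℝ) ^ (d + 1) * (ell (d + 1) Lc : ℝ)))))))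
            * (Tb * (KB * (2 * αΔ + 2 * αΔ * Lc * n) + (4 * (αΔ * αg) + 2 * (4 * (αΔ * αg)) * Lc * n) + KΔ * (2 * αg + 2 * αg * Lc * n))
              + TΔ * (KB * (2 * αg + 2 * αg * Lc * n) + (4 * (αg * αg) + 2 * (4 * (αg * αg)) * Lc * n) + KB * (2 * αg + 2 * αg * Lc * n))
              + Tb * (KΔ * (2 * αg + 2 * αg * Lc * n) + (4 * (αg * αΔ) + 2 * (4 * (αg * αΔ)) * Lc * n) + KB * (2 * αΔ + 2 * αΔ * Lc * n)))
            * ((((Lc ^ n : ℕ) : ℝ)) ^ (d + 1) * Zl (d + 1) (κ / (4 * ((d : ℝ) + 1))))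
            * Real.exp (-(κ / 12) * (supNorm (x' - z') + supNorm (u' - z')))) := by
  -- the classes: undressed legs enveloped ⇒ bounded and summable; the difference pair
  have hLn1 : 1 ≤ Lc ^ (n + 1) := Nat.one_le_pow _ _ hLc
  have hBb : ∀ μ z l u, |B μ z l u| ≤ KB := abs_le_of_env' hκ.le hB
  have hBs : ∀ μ z l, Summable fun u => B μ z l u := summable_of_env' hLn1 hκ hB
  have hBpb : ∀ μ z l u, |Bp μ z l u| ≤ KB := abs_le_of_env' hκ.le hBp
  have hBps : ∀ μ z l, Summable fun u => Bp μ z l u := summable_of_env' hLn1 hκ hBp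
  have hTΔ' : ∀ μ z κ u, |(Tp - T) μ z κ u| ≤ CTp + CT := fun μ z κ u => by
    simp only [Pi.sub_apply]
    exact (abs_sub _ _).trans (add_le_add (hTp μ z κ u) (hT μ z κ u))
  have hTΔs : ∀ μ z κ, Summable fun u => (Tp - T) μ z κ u := fun μ z κ =>
    ((hTps μ z κ).sub (hTs μ z κ)).congr fun u => by simp only [Pi.sub_apply]
  have hBΔ' : ∀ μ z l u, |(Bp - B) μ z l u| ≤ KΔ * Real.exp (-(κ * supNorm (quo (Lc ^ (n + 1)) u - z))) := fun μ z l u => by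
    simp only [Pi.sub_apply]; exact hBΔ μ z l u
  have hTBΔ : (Tp - T) - (Bp - B) = fun μ z κ u => dz (lamp μ z - lam μ z) κ u := by
    rw [show (Tp - T) - (Bp - B) = (Tp - Bp) - (T - B) by abel, hTBp, hTB]
    funext μ z κ u
    simp only [Pi.sub_apply, dz_sub]
  have hψΔ' : ∀ μ₀ z₀ u, (lamp μ₀ z₀ - lam μ₀ z₀) u = ∑ s ∈ Finset.range (n + 1), GΔ μ₀ z₀ s (blk (Lc ^ s) u) := fun μ₀ z₀ u => by
    rw [Pi.sub_apply]; exact hψΔ μ₀ z₀ u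
  have hMΔs : ∀ β z' μ, Summable fun z => (Mp - M) β z' μ z := fun β z' μ =>
    ((hMps β z' μ).sub (hMs β z' μ)).congr fun z => by simp only [Pi.sub_apply]
  have hMΔt' : ∀ (β : Fin (d + 1)) (z' : Site (d + 1)) (μ : Fin (d + 1)) (y : Site (d + 1)),
      |(Mp - M) β z' μ ((Lc : ℤ) • y)| ≤ TΔ * Real.exp (-(κ * supNorm (quo (Lc ^ n) y - z'))) := fun β z' μ y => by
    simp only [Pi.sub_apply]; exact hMΔt β z' μ y
  -- the telescoping, read entrywise
  have hS := locStencil_reslot_symVhSAt (d := d) hLc hrr Sum.inl Sum.inr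
  have e := pair_fm_eq_three (S := reslot Sum.inl Sum.inr (symVhSAt (toSite rr) d Lc rfl)) hT hTs hBb hBs hTp hTps hBpb hBps hMs hMps hS one_pos κ' u'
  have e' := congrFun (congrFun (congrFun (congrFun e x') z') (Sum.inl α)) (Sum.inl β)
  simp only [Pi.sub_apply, Pi.add_apply] at e'
  rw [e']
  -- the three sockets
  have h1 := abs_contact_border_fm_le₂ (d := d) (Lc := Lc) (rr := rr) (n := n) hLc hrr hκ hαΔ hαg hKΔ hKB hTb
    hTΔ' hTΔs hBΔ' hTBΔ hψΔ' hGΔ hTp hBp hTBp hψp hGp hMps hMpt κ' u' x' z' α β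
  have h2 := abs_contact_border_fm_le₂ (d := d) (Lc := Lc) (rr := rr) (n := n) hLc hrr hκ hαg hαg hKB hKB hTΔ
    hT hTs hB hTB hψ hG hTp hBp hTBp hψp hGp hMΔs hMΔt' κ' u' x' z' α β
  have h3 := abs_contact_border_fm_le₂ (d := d) (Lc := Lc) (rr := rr) (n := n) hLc hrr hκ hαg hαΔ hKB hKΔ hTb
    hT hTs hB hTB hψ hG hTΔ' hBΔ' hTBΔ hψΔ' hGΔ hMs hMt κ' u' x' z' α β
  refine ((abs_add_le _ _).trans (add_le_add ((abs_add_le _ _).trans (add_le_add h1 h2)) h3)).trans (le_of_eq ?_)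
  ring

end Fm

/-! ## §3 The entry bound of the mf pair -/

section Mf

variable [NeZero Lc] {n : ℕ} {κ αg αΔ KB KΔ CT CTp CM CMp Tb TΔ : ℝ}
  {T B Tp Bp M Mp : Fin (d + 1) → (Fin (d + 1) → ℤ) → Fin (d + 1) → (Fin (d + 1) → ℤ) → ℝ}
  {lam lamp : Fin (d + 1) → (Fin (d + 1) → ℤ) → (Fin (d + 1) → ℤ) → ℝ}
  {G Gp GΔ : Fin (d + 1) → (Fin (d + 1) → ℤ) → ℕ → Site (d + 1) → ℝ}

/-- NOT IN PRINT; OUR BOOKKEEPING ([folklore]; every analytic input a LETTER).  **THE ENTRY BOUND OF THE mf PAIR.**  Towers and difference letters as in §2; the multiplier LEFT legs `M′, M′⁺`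
bounded with summable fine slices, the tent of `M′` (centred at the output label `x′`) and the tent DIFFERENCE `T_Δ` (the taller multiplier's own tent is not needed: after the
telescoping only `M′⁺ − M′` and `M′` multiply).  THEN for all `κ′ u′ x′ z′ α β` (mf entries, `S′ = reslot inr inl V_ρ`):
`|(push₃ M′⁺ T⁺ T⁺ S′ − push₃ M′⁺ B⁺ B⁺ S′) − (push₃ M′ T T S′ − push₃ M′ B B S′)| ≤ (Lc^{d+1})⁻¹·((d+1)·(E₀²·Cnt))·[T_Δ·(K_B·A(α_g) + P(α_g,α_g) + K_B·A(α_g))`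
`+ T_b·(K_B·A(α_Δ) + P(α_Δ,α_g) + K_Δ·A(α_g)) + T_b·(K_Δ·A(α_g) + P(α_g,α_Δ) + K_B·A(α_Δ))]·((Lc^n)^{d+1}·Zl(κ∕(4(d+1))))·e^{−(κ∕12)(‖z′−x′‖∞+‖u′−x′‖∞)}`. -/
theorem abs_contact_border_mf_pair_le (hLc : 1 ≤ Lc) (hrr : rr ∈ box (d + 1) Lc) (hκ : 0 < κ) (hαg : 0 ≤ αg) (hαΔ : 0 ≤ αΔ) (hKB : 0 ≤ KB)
    (hKΔ : 0 ≤ KΔ) (hTb : 0 ≤ Tb) (hTΔ : 0 ≤ TΔ)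
    (hT : ∀ μ z κ u, |T μ z κ u| ≤ CT) (hTs : ∀ μ z κ, Summable fun u => T μ z κ u)
    (hB : ∀ μ z l u, |B μ z l u| ≤ KB * Real.exp (-(κ * supNorm (quo (Lc ^ (n + 1)) u - z))))
    (hTB : T - B = fun μ z κ u => dz (lam μ z) κ u)
    (hψ : ∀ μ₀ z₀ u, lam μ₀ z₀ u = ∑ s ∈ Finset.range (n + 1), G μ₀ z₀ s (blk (Lc ^ s) u))
    (hG : ∀ μ₀ z₀ s, s ≤ n → ∀ u, |G μ₀ z₀ s (blk (Lc ^ s) u)| ≤ αg * (Lc : ℝ) ^ s * Real.exp (-(κ * supNorm (quo (Lc ^ (n + 1)) u - z₀))))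
    (hTp : ∀ μ z κ u, |Tp μ z κ u| ≤ CTp) (hTps : ∀ μ z κ, Summable fun u => Tp μ z κ u)
    (hBp : ∀ μ z l u, |Bp μ z l u| ≤ KB * Real.exp (-(κ * supNorm (quo (Lc ^ (n + 1)) u - z))))
    (hTBp : Tp - Bp = fun μ z κ u => dz (lamp μ z) κ u)
    (hψp : ∀ μ₀ z₀ u, lamp μ₀ z₀ u = ∑ s ∈ Finset.range (n + 1), Gp μ₀ z₀ s (blk (Lc ^ s) u))
    (hGp : ∀ μ₀ z₀ s, s ≤ n → ∀ u, |Gp μ₀ z₀ s (blk (Lc ^ s) u)| ≤ αg * (Lc : ℝ) ^ s * Real.exp (-(κ * supNorm (quo (Lc ^ (n + 1)) u - z₀))))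
    (hBΔ : ∀ μ z l u, |Bp μ z l u - B μ z l u| ≤ KΔ * Real.exp (-(κ * supNorm (quo (Lc ^ (n + 1)) u - z))))
    (hψΔ : ∀ μ₀ z₀ u, lamp μ₀ z₀ u - lam μ₀ z₀ u = ∑ s ∈ Finset.range (n + 1), GΔ μ₀ z₀ s (blk (Lc ^ s) u))
    (hGΔ : ∀ μ₀ z₀ s, s ≤ n → ∀ u, |GΔ μ₀ z₀ s (blk (Lc ^ s) u)| ≤ αΔ * (Lc : ℝ) ^ s * Real.exp (-(κ * supNorm (quo (Lc ^ (n + 1)) u - z₀))))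
    (hM : ∀ α x' μ x, |M α x' μ x| ≤ CM) (hMs : ∀ α x' μ, Summable fun x => M α x' μ x)
    (hMp : ∀ α x' μ x, |Mp α x' μ x| ≤ CMp) (hMps : ∀ α x' μ, Summable fun x => Mp α x' μ x)
    (hMt : ∀ (α : Fin (d + 1)) (x' : Site (d + 1)) (μ : Fin (d + 1)) (y : Site (d + 1)),
      |M α x' μ ((Lc : ℤ) • y)| ≤ Tb * Real.exp (-(κ * supNorm (quo (Lc ^ n) y - x'))))
    (hMΔt : ∀ (α : Fin (d + 1)) (x' : Site (d + 1)) (μ : Fin (d + 1)) (y : Site (d + 1)),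
      |Mp α x' μ ((Lc : ℤ) • y) - M α x' μ ((Lc : ℤ) • y)| ≤ TΔ * Real.exp (-(κ * supNorm (quo (Lc ^ n) y - x'))))
    (κ' : Fin (d + 1)) (u' x' z' : Site (d + 1)) (α β : Fin (d + 1)) :
    |(push₃ Mp Tp Tp (reslot Sum.inr Sum.inl (symVhSAt (toSite rr) d Lc rfl)) κ' u' x' z' (Sum.inl α) (Sum.inl β)
          - push₃ Mp Bp Bp (reslot Sum.inr Sum.inl (symVhSAt (toSite rr) d Lc rfl)) κ' u' x' z' (Sum.inl α) (Sum.inl β))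
        - (push₃ M T T (reslot Sum.inr Sum.inl (symVhSAt (toSite rr) d Lc rfl)) κ' u' x' z' (Sum.inl α) (Sum.inl β)
          - push₃ M B B (reslot Sum.inr Sum.inl (symVhSAt (toSite rr) d Lc rfl)) κ' u' x' z' (Sum.inl α) (Sum.inl β))|
      ≤ ((((d + 1).factorial : ℕ) : ℝ) * (Lc : ℝ) ^ (d + 1))⁻¹ *
          ((((d : ℝ) + 1) * (Real.exp (2 * ((d : ℝ) + 1) * κ) ^ 2 *
              (((2 * Lc : ℕ) : ℝ) ^ (d + 1) * (((d + 1 : ℕ) : ℝ) * ((((d + 1).factorial : ℕ) : ℝ) * ((Lc : ℝ) ^ (d + 1) * (ell (d + 1) Lc : ℝ)))))))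
            * (TΔ * (KB * (2 * αg + 2 * αg * Lc * n) + (4 * (αg * αg) + 2 * (4 * (αg * αg)) * Lc * n) + KB * (2 * αg + 2 * αg * Lc * n))
              + Tb * (KB * (2 * αΔ + 2 * αΔ * Lc * n) + (4 * (αΔ * αg) + 2 * (4 * (αΔ * αg)) * Lc * n) + KΔ * (2 * αg + 2 * αg * Lc * n))
              + Tb * (KΔ * (2 * αg + 2 * αg * Lc * n) + (4 * (αg * αΔ) + 2 * (4 * (αg * αΔ)) * Lc * n) + KB * (2 * αΔ + 2 * αΔ * Lc * n)))
            * ((((Lc ^ n : ℕ) : ℝ)) ^ (d + 1) * Zl (d + 1) (κ / (4 * ((d : ℝ) + 1))))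
            * Real.exp (-(κ / 12) * (supNorm (z' - x') + supNorm (u' - x')))) := by
  have hLn1 : 1 ≤ Lc ^ (n + 1) := Nat.one_le_pow _ _ hLc
  have hBb : ∀ μ z l u, |B μ z l u| ≤ KB := abs_le_of_env' hκ.le hB
  have hBs : ∀ μ z l, Summable fun u => B μ z l u := summable_of_env' hLn1 hκ hB
  have hBpb : ∀ μ z l u, |Bp μ z l u| ≤ KB := abs_le_of_env' hκ.le hBp
  have hBps : ∀ μ z l, Summable fun u => Bp μ z l u := summable_of_env' hLn1 hκ hBp
  have hTΔ' : ∀ μ z κ u, |(Tp - T) μ z κ u| ≤ CTp + CT := fun μ z κ u => by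
    simp only [Pi.sub_apply]
    exact (abs_sub _ _).trans (add_le_add (hTp μ z κ u) (hT μ z κ u))
  have hTΔs : ∀ μ z κ, Summable fun u => (Tp - T) μ z κ u := fun μ z κ =>
    ((hTps μ z κ).sub (hTs μ z κ)).congr fun u => by simp only [Pi.sub_apply]
  have hBΔ' : ∀ μ z l u, |(Bp - B) μ z l u| ≤ KΔ * Real.exp (-(κ * supNorm (quo (Lc ^ (n + 1)) u - z))) := fun μ z l u => by
    simp only [Pi.sub_apply]; exact hBΔ μ z l u
  have hTBΔ : (Tp - T) - (Bp - B) = fun μ z κ u => dz (lamp μ z - lam μ z) κ u := by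
    rw [show (Tp - T) - (Bp - B) = (Tp - Bp) - (T - B) by abel, hTBp, hTB]
    funext μ z κ u
    simp only [Pi.sub_apply, dz_sub]
  have hψΔ' : ∀ μ₀ z₀ u, (lamp μ₀ z₀ - lam μ₀ z₀) u = ∑ s ∈ Finset.range (n + 1), GΔ μ₀ z₀ s (blk (Lc ^ s) u) := fun μ₀ z₀ u => by
    rw [Pi.sub_apply]; exact hψΔ μ₀ z₀ u
  have hMΔ' : ∀ α x' μ x, |(Mp - M) α x' μ x| ≤ CMp + CM := fun α x' μ x => by
    simp only [Pi.sub_apply]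
    exact (abs_sub _ _).trans (add_le_add (hMp α x' μ x) (hM α x' μ x))
  have hMΔs : ∀ α x' μ, Summable fun x => (Mp - M) α x' μ x := fun α x' μ =>
    ((hMps α x' μ).sub (hMs α x' μ)).congr fun x => by simp only [Pi.sub_apply]
  have hMΔt' : ∀ (α : Fin (d + 1)) (x' : Site (d + 1)) (μ : Fin (d + 1)) (y : Site (d + 1)),
      |(Mp - M) α x' μ ((Lc : ℤ) • y)| ≤ TΔ * Real.exp (-(κ * supNorm (quo (Lc ^ n) y - x'))) := fun α x' μ y => by
    simp only [Pi.sub_apply]; exact hMΔt α x' μ y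
  -- the telescoping, read entrywise
  have hS := locStencil_reslot_symVhSAt (d := d) hLc hrr Sum.inr Sum.inl
  have e := pair_mf_eq_three (S := reslot Sum.inr Sum.inl (symVhSAt (toSite rr) d Lc rfl)) hM hMs hMp hMps hT hTs hBb hBs hTp hTps hBpb hBps hS one_pos κ' u'
  have e' := congrFun (congrFun (congrFun (congrFun e x') z') (Sum.inl α)) (Sum.inl β)
  simp only [Pi.sub_apply, Pi.add_apply] at e'
  rw [e']
  -- the three sockets
  have h1 := abs_contact_border_mf_le₂ (d := d) (Lc := Lc) (rr := rr) (n := n) hLc hrr hκ hαg hαg hKB hKB hTΔ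
    hTp hTps hBp hTBp hψp hGp hTp hBp hTBp hψp hGp hMΔ' hMΔs hMΔt' κ' u' x' z' α β
  have h2 := abs_contact_border_mf_le₂ (d := d) (Lc := Lc) (rr := rr) (n := n) hLc hrr hκ hαΔ hαg hKΔ hKB hTb
    hTΔ' hTΔs hBΔ' hTBΔ hψΔ' hGΔ hTp hBp hTBp hψp hGp hM hMs hMt κ' u' x' z' α β
  have h3 := abs_contact_border_mf_le₂ (d := d) (Lc := Lc) (rr := rr) (n := n) hLc hrr hκ hαg hαΔ hKB hKΔ hTb
    hT hTs hB hTB hψ hG hTΔ' hBΔ' hTBΔ hψΔ' hGΔ hM hMs hMt κ' u' x' z' α β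
  refine ((abs_add_le _ _).trans (add_le_add ((abs_add_le _ _).trans (add_le_add h1 h2)) h3)).trans (le_of_eq ?_)
  ring

end Mf

end Summit.QuantumFields.BalabanUV.Beta.GAN24.SymContactBorderPairEntryBound

end
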